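import Mathlib
import HarnessLib
import Summits.HubbardSuperconductivity.HubbardSuperconductivity.Theorems.KLProgrammeC4aAbsBubbleDominatorUpto
import Summits.HubbardSuperconductivity.HubbardSuperconductivity.Theorems.KLProgrammeC4aBoxIntegralContinuityCfg

/-!
# Route `KLProgramme` — crux C4a, S3 brick (B4) «(U1)-HYBRID» B-1 (ii): THE LEVEL AND `ϑ` LAYERS OF THE DIRECT PARTS — a per-level-line bound by the `k = 0`
# envelope line integrates to an `n`-free angular bound `Λ·(4·2π(K₀ + P(1 + log⁺(M/π))) + 8π²W)` over the full loop-level range `[−hi, hi]`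

Cell `gate-hubbard-kl`, seat hubbard-kl-k3c3-p3 (g37; row «implicit-function / monotonicity route for μ(n)»).  Located brick for the (C)-closer lane / the `M₁`
assembly (stub (C) `stub_twoLeg_curvature` of `KLRegimeEngineV17F2`, stmt-HubbardSuperconductivity-20437), memo HOME/hubbard-kl-k3c3-p3/U1-CAUSTIC-SUP.md §19 (B-1).

WHY.  D-2c / D-3d (`…C4aUmkDirectTangencyLine`, `…C4aUmkDirectCooperLine`) bound the direct tangency / Cooper parts of the first-order layer on ONE level line by
`Λ(e)·∫ (max m |ē|)⁻¹ dv` with the kernel scale `m = max lo |e|` (`|e|` off the Fermi strip, `lo` on it); after `|e|/m ≤ 1`, `|ρ|/m ≤ |ρ|/lo` the factor is a constant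
`Λ`.  This file integrates such a line bound over the loop levels `e ∈ [−hi, hi]` (weight `0 ≤ wt ≤ W`) and the relative angle `ϑ ∈ (0, 2π]`: the Fermi strip `|e| ≤ lo` is
trivial (`(max lo |ē|)⁻¹ ≤ 1/lo` on a strip of width `2lo`: `≤ 4πW`), the positive levels are the `k = 0` dominator and the negative levels its twin
(`…C4aAbsBubbleDominatorUpto`, floors `t = id`), and the `ϑ` layer is `…C4aAbsBubbleDominatorIntegrable.setIntegral_posLog_div_torusDist_sub_pi_le`.  The line bound is
asked on `ϑ ∈ (0,2π) ∖ {π}` only (a null set is free; D-2c excludes the tangency angle, the dominator the Cooper angle).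
* `continuousOn_level_invEnvelopeLine` — `e ↦ ∫ (max (max lo |e|) |ē(e,v)|)⁻¹ dv` is continuous on `[−hi, hi]` (clamp + joint continuity);
* **`setIntegral_abs_levelBox_le_of_lineBound`** (HEADLINE): with the dominator data `(hi₀, K₀, P, M)` of `exists_absBubble_dominator_upto` (`a = −π`, `b = π`),
  `0 < lo ≤ hi ≤ hi₀`, `|ρ| < r`, `wt` continuous with `0 ≤ wt ≤ W` on `[−hi,hi]`, and the line bound
  `|∫_{−π}^{π} X(ϑ,e,v)·(K e)′(ē) dv| ≤ Λ·∫_{−π}^{π} (max (max lo |e|) |ē|)⁻¹ dv` for `ϑ ∈ (0,2π) ∖ {π}`, `e ∈ [−hi,hi]`: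
  `∫_{(0,2π]} |∫_{−hi}^{hi} wt(e)·∫_{−π}^{π} X·(K e)′(ē) dv de| dϑ ≤ Λ·(2·(2π(K₀ + P(1 + log⁺(M/π)))) + 2π·(4πW))`.
Pure bookkeeping on landed objects; nothing asserts (C), K3 or superconductivity.
References: Salmhofer 1999 §4.5.3 [cite: Salmhofer1999]; FST II CPAM 51 (1998) §3 [cite: FeldmanSalmhoferTrubowitz1998]; BGM 2006 §2.4 [cite: BenfattoGiulianiMastropietro2006].
-/

noncomputable section

namespace Summit.HubbardSuperconductivity.HubbardSuperconductivity.Theorems.C4a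

set_option linter.dupNamespace false -- summit = problem name (single-conjunct summit), D-0017

open Real Set MeasureTheory intervalIntegral
open scoped Interval
open Literature.MathematicalPhysics.QuantumLattice Literature.MathematicalPhysics.QuantumLattice.BandSectorCounting
open Literature.MathematicalPhysics.QuantumLattice.FermiRG
open Summit.HubbardSuperconductivity.HubbardSuperconductivity.Theorems.KLRegimeSplit
open Summit.HubbardSuperconductivity.HubbardSuperconductivity.Theorems.DispersionFlow
open Summit.HubbardSuperconductivity.HubbardSuperconductivity.Theorems.PerturbedFermiCurve

section Sizes

variable {K : TrigPolyC4v} {A : ℝ} (hA : ∀ p : Momentum, ∀ j ≤ 2, ‖iteratedFDeriv ℝ j (frameShift K) p‖ ≤ A) (hA20 : A ≤ 1 / 20)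
  (hd : klCurveD ≤ (bandBounds (show (-4 : ℝ) < -1.1 by norm_num) (show (-1.1 : ℝ) ≤ -0.1 by norm_num)
    (show (-0.1 : ℝ) < 0 by norm_num)).Dtmin - 2 * A)
  {μ r : ℝ} (hr : 0 < r) (hlo : (-1.1 : ℝ) < μ - r - A) (hhi : μ + r + A < -0.1)
include hA hA20 hd hr hlo hhi

omit hA20 hr in
/-- **The `k = 0` envelope line is continuous in the loop level on `[−hi, hi]`** (`hi < r`, `lo > 0`):
`e ↦ ∫_{−π}^{π} (max (max lo |e|) |e_K(S − Φ(e,v+θ))|)⁻¹ dv`. -/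
theorem continuousOn_level_invEnvelopeLine {ρ : ℝ} (ϑ θ : ℝ) {lo hi : ℝ} (hlo0 : 0 < lo) (hhi0 : 0 ≤ hi) (hhir : hi < r) :
    ContinuousOn (fun e : ℝ => ∫ v in (-π)..π,
      (max (max lo |e|) |frameLevel μ K (pairSumPath μ K ρ ϑ θ 0 - levelPoint μ K e (v + θ))|)⁻¹) (Icc (-hi) hi) := by
  set B := bandBounds (show (-4 : ℝ) < -1.1 by norm_num) (show (-1.1 : ℝ) ≤ -0.1 by norm_num) (show (-0.1 : ℝ) < 0 by norm_num) with hBdef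
  have hADt : 2 * A < B.Dtmin := by have := klCurveD_pos; linarith only [this, hd]
  have hlev : ContinuousOn (fun p : ℝ × ℝ => levelPoint μ K p.1 p.2) ({x : ℝ | |x| < r} ×ˢ univ) :=
    (contDiffOn_levelPoint B hA hADt hlo hhi (m := 0)).continuousOn
  have hfl : Continuous (frameLevel μ K) := (EngineV8.contDiff_frameLevel μ K (n := 0)).continuous
  have hhh : -hi ≤ hi := by linarith only [hhi0]
  -- the clamp of the loop level, as a function of `p = (e, v)`
  have hcl : Continuous fun p : ℝ × ℝ => max (-hi) (min p.1 hi) := continuous_const.max ((continuous_fst).min continuous_const)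
  have hclI : ∀ p : ℝ × ℝ, max (-hi) (min p.1 hi) ∈ Icc (-hi) hi := fun p => ⟨le_max_left _ _, max_le hhh (min_le_right _ _)⟩
  have hclr : ∀ p : ℝ × ℝ, |max (-hi) (min p.1 hi)| < r := fun p =>
    abs_lt.2 ⟨by linarith only [(hclI p).1, hhir], lt_of_le_of_lt (hclI p).2 hhir⟩
  have hL := hlev.comp_continuous (f := fun p : ℝ × ℝ => ((max (-hi) (min p.1 hi), p.2 + θ) : ℝ × ℝ))
    (hcl.prodMk (continuous_snd.add continuous_const)) fun p => mem_prod.2 ⟨hclr p, mem_univ _⟩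
  have hL' : Continuous fun p : ℝ × ℝ => levelPoint μ K (max (-hi) (min p.1 hi)) (p.2 + θ) := hL.congr fun _ => rfl
  have hband : Continuous fun p : ℝ × ℝ => frameLevel μ K (pairSumPath μ K ρ ϑ θ 0 - levelPoint μ K (max (-hi) (min p.1 hi)) (p.2 + θ)) :=
    hfl.comp (continuous_const.sub hL')
  have hmax : Continuous fun p : ℝ × ℝ => max (max lo |max (-hi) (min p.1 hi)|)
      |frameLevel μ K (pairSumPath μ K ρ ϑ θ 0 - levelPoint μ K (max (-hi) (min p.1 hi)) (p.2 + θ))| :=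
    (continuous_const.max ((continuous_const.max (continuous_fst.min continuous_const)).abs)).max hband.abs
  have hne : ∀ p : ℝ × ℝ, max (max lo |max (-hi) (min p.1 hi)|)
      |frameLevel μ K (pairSumPath μ K ρ ϑ θ 0 - levelPoint μ K (max (-hi) (min p.1 hi)) (p.2 + θ))| ≠ 0 := fun p =>
    ne_of_gt (lt_of_lt_of_le hlo0 ((le_max_left _ _).trans (le_max_left _ _)))
  have hj : Continuous fun p : ℝ × ℝ => (max (max lo |max (-hi) (min p.1 hi)|)
      |frameLevel μ K (pairSumPath μ K ρ ϑ θ 0 - levelPoint μ K (max (-hi) (min p.1 hi)) (p.2 + θ))|)⁻¹ := hmax.inv₀ hne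
  have hI : Continuous fun e : ℝ => ∫ v in (-π)..π, (max (max lo |max (-hi) (min e hi)|)
      |frameLevel μ K (pairSumPath μ K ρ ϑ θ 0 - levelPoint μ K (max (-hi) (min e hi)) (v + θ))|)⁻¹ :=
    intervalIntegral.continuous_parametric_intervalIntegral_of_continuous' (f := fun e v => (max (max lo |max (-hi) (min e hi)|)
      |frameLevel μ K (pairSumPath μ K ρ ϑ θ 0 - levelPoint μ K (max (-hi) (min e hi)) (v + θ))|)⁻¹) hj (-π) π
  refine (hI.continuousOn (s := Icc (-hi) hi)).congr fun e he => ?_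
  simp only [min_eq_left he.2, max_eq_right he.1]

omit hA20 hr in
/-- **THE LEVEL AND `ϑ` LAYERS OF A DIRECT PART** (HEADLINE; see the module docstring). [cite: Salmhofer1999, §4.5.3 Cor. 4.11] -/
theorem setIntegral_abs_levelBox_le_of_lineBound {hi₀ K₀ P M W : ℝ} (hP : 0 ≤ P) (hW : 0 ≤ W)
    (hdom : ∀ (hi ρ θ lo : ℝ) (t wt : ℝ → ℝ), 0 < hi → hi ≤ hi₀ → |ρ| < r → 0 < lo → lo ≤ hi → (∀ e ∈ Icc lo hi, e ≤ t e) →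
      (∀ e ∈ Icc lo hi, 0 ≤ wt e) → (∀ e ∈ Icc lo hi, wt e ≤ W) → ∀ ϑ : ℝ, 0 < FermiRG.torusDist (ϑ - π) →
        (∫ e in lo..hi, wt e * ∫ x in Icc (-π) π, (max (t e) |frameLevel μ K (pairSumPath μ K ρ ϑ θ 0 - levelPoint μ K e (x + θ))|)⁻¹) ≤
            K₀ + P * log⁺ (M / FermiRG.torusDist (ϑ - π)) ∧
          (∫ e in lo..hi, wt e * ∫ x in Icc (-π) π, (max (t e) |frameLevel μ K (pairSumPath μ K ρ ϑ θ 0 - levelPoint μ K (-e) (x + θ))|)⁻¹) ≤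
            K₀ + P * log⁺ (M / FermiRG.torusDist (ϑ - π)))
    {hi lo ρ : ℝ} (θ : ℝ) (hlo0 : 0 < lo) (hlohi : lo ≤ hi) (hhi₀ : hi ≤ hi₀) (hhir : hi < r) (hρ : |ρ| < r) {wt : ℝ → ℝ}
    (hwc : ContinuousOn wt (Icc (-hi) hi)) (hw0 : ∀ e ∈ Icc (-hi) hi, 0 ≤ wt e) (hwW : ∀ e ∈ Icc (-hi) hi, wt e ≤ W)
    {X : ℝ → ℝ → ℝ → ℝ} {Kr : ℝ → ℝ → ℝ} {Λ : ℝ} (hΛ : 0 ≤ Λ)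
    (hline : ∀ ϑ ∈ Ioo 0 (2 * π), ϑ ≠ π → ∀ e ∈ Icc (-hi) hi,
      |∫ v in (-π)..π, X ϑ e v * deriv (Kr e) (frameLevel μ K (pairSumPath μ K ρ ϑ θ 0 - levelPoint μ K e (v + θ)))| ≤
        Λ * ∫ v in (-π)..π, (max (max lo |e|) |frameLevel μ K (pairSumPath μ K ρ ϑ θ 0 - levelPoint μ K e (v + θ))|)⁻¹) :
    ∫ ϑ in Ioc 0 (2 * π), |∫ e in (-hi)..hi, wt e * ∫ v in (-π)..π,
        X ϑ e v * deriv (Kr e) (frameLevel μ K (pairSumPath μ K ρ ϑ θ 0 - levelPoint μ K e (v + θ)))| ≤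
      Λ * (2 * (2 * π * (K₀ + P * (1 + log⁺ (M / π)))) + 2 * π * (4 * π * W)) := by
  have hπ := Real.pi_pos
  have hhi0 : 0 < hi := hlo0.trans_le hlohi
  have hposlog : ∀ y : ℝ, 0 ≤ log⁺ y := fun y => Real.posLog_nonneg
  -- abbreviations per ϑ
  set ē : ℝ → ℝ → ℝ → ℝ := fun ϑ e v => frameLevel μ K (pairSumPath μ K ρ ϑ θ 0 - levelPoint μ K e (v + θ)) with hē
  set J : ℝ → ℝ → ℝ := fun ϑ e => ∫ v in (-π)..π, (max (max lo |e|) |ē ϑ e v|)⁻¹ with hJ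
  set D : ℝ → ℝ := fun ϑ => Λ * (2 * K₀ + 4 * π * W) + Λ * 2 * P * log⁺ (M / FermiRG.torusDist (ϑ - π)) with hD
  -- §1 the pointwise bound in ϑ
  have hpt : ∀ ϑ ∈ Ioo 0 (2 * π), ϑ ≠ π →
      |∫ e in (-hi)..hi, wt e * ∫ v in (-π)..π, X ϑ e v * deriv (Kr e) (ē ϑ e v)| ≤ D ϑ := by
    intro ϑ hϑI hϑπ
    have hϑT : 0 < FermiRG.torusDist (ϑ - π) := by
      rw [torusDist_eq_abs_of_abs_le_pi (abs_le.2 ⟨by linarith [hϑI.1], by linarith [hϑI.2]⟩)]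
      exact abs_pos.2 (sub_ne_zero.2 hϑπ)
    -- the majorant `g e = wt e * (Λ * J e)` and its integrability
    have hJc : ContinuousOn (J ϑ) (Icc (-hi) hi) := continuousOn_level_invEnvelopeLine hA hd hlo hhi ϑ θ hlo0 hhi0.le hhir
    have hgc : ContinuousOn (fun e => wt e * (Λ * J ϑ e)) (Icc (-hi) hi) := hwc.mul (continuousOn_const.mul hJc)
    have hgi : ∀ {c d : ℝ}, -hi ≤ c → c ≤ d → d ≤ hi → IntervalIntegrable (fun e => wt e * (Λ * J ϑ e)) volume c d := by
      intro c d hc hcd hdd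
      exact (hgc.mono (by rw [uIcc_of_le hcd]; exact Icc_subset_Icc hc hdd)).intervalIntegrable
    have hJ0 : ∀ e, 0 ≤ J ϑ e := fun e =>
      intervalIntegral.integral_nonneg (by linarith) fun v _ => inv_nonneg.2 ((hlo0.le.trans (le_max_left _ _)).trans (le_max_left _ _))
    have hg0 : ∀ e ∈ Icc (-hi) hi, 0 ≤ wt e * (Λ * J ϑ e) := fun e he => mul_nonneg (hw0 e he) (mul_nonneg hΛ (hJ0 e))
    -- step 1: |∫ wt·I| ≤ ∫ wt·Λ·J
    have h1 : |∫ e in (-hi)..hi, wt e * ∫ v in (-π)..π, X ϑ e v * deriv (Kr e) (ē ϑ e v)| ≤ ∫ e in (-hi)..hi, wt e * (Λ * J ϑ e) := by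
      rw [← Real.norm_eq_abs]
      refine intervalIntegral.norm_integral_le_of_norm_le (by linarith) (Filter.Eventually.of_forall fun e he => ?_) (hgi le_rfl (by linarith) le_rfl)
      have heI : e ∈ Icc (-hi) hi := ⟨he.1.le, he.2⟩
      rw [norm_mul, Real.norm_eq_abs, Real.norm_eq_abs, abs_of_nonneg (hw0 e heI)]
      exact mul_le_mul_of_nonneg_left (hline ϑ hϑI hϑπ e heI) (hw0 e heI)
    -- step 2: split the level range
    have hsplit : ∫ e in (-hi)..hi, wt e * (Λ * J ϑ e) =
        (∫ e in (-hi)..(-lo), wt e * (Λ * J ϑ e)) + (∫ e in (-lo)..lo, wt e * (Λ * J ϑ e)) + ∫ e in lo..hi, wt e * (Λ * J ϑ e) := by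
      rw [intervalIntegral.integral_add_adjacent_intervals (hgi le_rfl (by linarith) (by linarith)) (hgi (by linarith) (by linarith) (by linarith)),
        intervalIntegral.integral_add_adjacent_intervals (hgi le_rfl (by linarith) (by linarith)) (hgi (by linarith) hlohi le_rfl)]
    -- step 3: positive levels
    have hpos : ∫ e in lo..hi, wt e * (Λ * J ϑ e) ≤ Λ * (K₀ + P * log⁺ (M / FermiRG.torusDist (ϑ - π))) := by
      have hd := (hdom hi ρ θ lo (fun e => e) wt hhi0 hhi₀ hρ hlo0 hlohi (fun e _ => le_rfl)
        (fun e he => hw0 e ⟨by linarith [he.1], he.2⟩) (fun e he => hwW e ⟨by linarith [he.1], he.2⟩) ϑ hϑT).1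
      have heq : ∫ e in lo..hi, wt e * (Λ * J ϑ e) = Λ * ∫ e in lo..hi, wt e * ∫ x in Icc (-π) π, (max e |ē ϑ e x|)⁻¹ := by
        rw [← intervalIntegral.integral_const_mul]
        refine intervalIntegral.integral_congr fun e he => ?_
        rw [uIcc_of_le hlohi] at he
        have hme : max lo |e| = e := by rw [abs_of_pos (hlo0.trans_le he.1), max_eq_right he.1]
        simp only [hJ, hme, intervalIntegral.integral_of_le (show -π ≤ π by linarith), integral_Icc_eq_integral_Ioc]
        ring
      rw [heq]; exact mul_le_mul_of_nonneg_left hd hΛ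
    -- step 4: negative levels
    have hneg : ∫ e in (-hi)..(-lo), wt e * (Λ * J ϑ e) ≤ Λ * (K₀ + P * log⁺ (M / FermiRG.torusDist (ϑ - π))) := by
      have hd := (hdom hi ρ θ lo (fun e => e) (fun e => wt (-e)) hhi0 hhi₀ hρ hlo0 hlohi (fun e _ => le_rfl)
        (fun e he => hw0 (-e) ⟨by linarith [he.2], by linarith [he.1]⟩) (fun e he => hwW (-e) ⟨by linarith [he.2], by linarith [he.1]⟩) ϑ hϑT).2
      have heq : ∫ e in (-hi)..(-lo), wt e * (Λ * J ϑ e) = Λ * ∫ e in lo..hi, wt (-e) * ∫ x in Icc (-π) π, (max e |ē ϑ (-e) x|)⁻¹ := by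
        rw [← intervalIntegral.integral_const_mul]
        have hc : (∫ e in (-hi)..(-lo), wt e * (Λ * J ϑ e)) = ∫ e in lo..hi, wt (-e) * (Λ * J ϑ (-e)) := by
          rw [← intervalIntegral.integral_comp_neg fun e => wt e * (Λ * J ϑ e)]
        rw [hc]
        refine intervalIntegral.integral_congr fun e he => ?_
        rw [uIcc_of_le hlohi] at he
        have hme : max lo |-e| = e := by rw [abs_neg, abs_of_pos (hlo0.trans_le he.1), max_eq_right he.1]
        simp only [hJ, hme, intervalIntegral.integral_of_le (show -π ≤ π by linarith), integral_Icc_eq_integral_Ioc]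
        ring
      rw [heq]; exact mul_le_mul_of_nonneg_left hd hΛ
    -- step 5: the Fermi strip
    have hstrip : ∫ e in (-lo)..lo, wt e * (Λ * J ϑ e) ≤ Λ * (4 * π * W) := by
      have hb : ∀ e ∈ Ι (-lo) lo, ‖wt e * (Λ * J ϑ e)‖ ≤ W * (Λ * (2 * π / lo)) := by
        intro e he
        rw [uIoc_of_le (by linarith)] at he
        have heI : e ∈ Icc (-hi) hi := ⟨by linarith [he.1], by linarith [he.2]⟩
        have hme : max lo |e| = lo := max_eq_left (abs_le.2 ⟨he.1.le, he.2⟩)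
        have hJle : J ϑ e ≤ 2 * π / lo := by
          have h := intervalIntegral.norm_integral_le_of_norm_le_const (a := -π) (b := π) (C := lo⁻¹)
            (f := fun v => (max (max lo |e|) |ē ϑ e v|)⁻¹) fun v _ => by
              rw [Real.norm_eq_abs, abs_of_nonneg (inv_nonneg.2 ((hlo0.le.trans (le_max_left _ _)).trans (le_max_left _ _))), hme]
              exact inv_anti₀ hlo0 (le_max_left _ _)
          rw [Real.norm_eq_abs, abs_of_nonneg (hJ0 e), show π - -π = 2 * π by ring, abs_of_pos (by positivity : (0 : ℝ) < 2 * π)] at h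
          calc J ϑ e ≤ lo⁻¹ * (2 * π) := h
            _ = 2 * π / lo := by rw [inv_mul_eq_div]
        rw [Real.norm_eq_abs, abs_of_nonneg (hg0 e heI)]
        exact mul_le_mul (hwW e heI) (mul_le_mul_of_nonneg_left hJle hΛ) (mul_nonneg hΛ (hJ0 e)) hW
      have h := intervalIntegral.norm_integral_le_of_norm_le_const hb
      rw [Real.norm_eq_abs, show lo - -lo = 2 * lo by ring, abs_of_pos (by positivity : (0 : ℝ) < 2 * lo)] at h
      calc ∫ e in (-lo)..lo, wt e * (Λ * J ϑ e) ≤ |∫ e in (-lo)..lo, wt e * (Λ * J ϑ e)| := le_abs_self _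
        _ ≤ W * (Λ * (2 * π / lo)) * (2 * lo) := h
        _ = Λ * (4 * π * W) := by field_simp; ring
    calc _ ≤ ∫ e in (-hi)..hi, wt e * (Λ * J ϑ e) := h1
      _ = _ := hsplit
      _ ≤ Λ * (K₀ + P * log⁺ (M / FermiRG.torusDist (ϑ - π))) + Λ * (4 * π * W) + Λ * (K₀ + P * log⁺ (M / FermiRG.torusDist (ϑ - π))) := by linarith
      _ = D ϑ := by rw [hD]; ring
  -- §2 the ϑ layer
  have hlogi : IntegrableOn (fun ϑ : ℝ => log⁺ (M / FermiRG.torusDist (ϑ - π))) (Ioc 0 (2 * π)) := integrableOn_posLog_div_torusDist_sub_pi M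
  have hDi : IntegrableOn D (Ioc 0 (2 * π)) :=
    (integrable_const (Λ * (2 * K₀ + 4 * π * W))).add (hlogi.const_mul (Λ * 2 * P))
  have hae : ∀ᵐ ϑ ∂(volume.restrict (Ioc 0 (2 * π))),
      |∫ e in (-hi)..hi, wt e * ∫ v in (-π)..π, X ϑ e v * deriv (Kr e) (ē ϑ e v)| ≤ D ϑ := by
    have hnull : volume ({π, 2 * π} : Set ℝ) = 0 := Set.Finite.measure_zero (by simp) volume
    have hae' : ∀ᵐ ϑ ∂(volume : Measure ℝ), ϑ ∉ ({π, 2 * π} : Set ℝ) := measure_eq_zero_iff_ae_notMem.1 hnull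
    filter_upwards [ae_restrict_mem measurableSet_Ioc, ae_restrict_of_ae hae'] with ϑ hϑ hϑn
    have hϑπ : ϑ ≠ π := fun h => hϑn (by simp [h])
    have hϑ2 : ϑ ≠ 2 * π := fun h => hϑn (by simp [h])
    exact hpt ϑ ⟨hϑ.1, lt_of_le_of_ne hϑ.2 hϑ2⟩ hϑπ
  have hmono := integral_mono_of_nonneg (μ := volume.restrict (Ioc 0 (2 * π))) (Filter.Eventually.of_forall fun ϑ => abs_nonneg _) hDi hae
  refine hmono.trans ?_
  have hDint : ∫ ϑ in Ioc 0 (2 * π), D ϑ =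
      Λ * (2 * K₀ + 4 * π * W) * (2 * π) + Λ * 2 * P * ∫ ϑ in Ioc 0 (2 * π), log⁺ (M / FermiRG.torusDist (ϑ - π)) := by
    simp only [hD]
    rw [integral_add (integrable_const _) (hlogi.const_mul (Λ * 2 * P)), setIntegral_const, smul_eq_mul, MeasureTheory.integral_const_mul,
      Real.volume_real_Ioc_of_le (by linarith)]
    ring
  rw [hDint]
  have hlay := setIntegral_posLog_div_torusDist_sub_pi_le (M := M) le_rfl (zero_le_one)
  have hlay' : ∫ ϑ in Ioc 0 (2 * π), log⁺ (M / FermiRG.torusDist (ϑ - π)) ≤ 2 * π * (1 + log⁺ (M / π)) := by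
    have h := hlay; simp only [zero_add, one_mul] at h; exact h
  have hc : 0 ≤ Λ * 2 * P := by positivity
  nlinarith [mul_le_mul_of_nonneg_left hlay' hc, hposlog (M / π)]

end Sizes

end Summit.HubbardSuperconductivity.HubbardSuperconductivity.Theorems.C4a

end
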